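import Mathlib
import Literature.MathematicalPhysics.QuantumFieldTheory.Balaban1983to89.B5Hk165ActionZd

/-!
# Bałaban [B5] (1.67), LEFT half, scalar, whole lattice `ℤ^d`: `⟨∂₁B, ∂₁B⟩ ≤ ⟨B, Δ_kB⟩` with `γ₀ = 1`,
# through the `H¹`-stability of block averaging `⟨∂₁(Q'A), ∂₁(Q'A)⟩ ≤ ⟨∂A, ∂A⟩` (constant `1`)

**Source (verbatim; the quotation LOCATES the inequality — nothing printed is used as a hypothesis).**
[B5] = T. Bałaban, *Propagators and renormalization transformations for lattice gauge theories. I*, Commun. Math.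
Phys. **95** (1984) 17–40 [`Balaban1984PropagatorsI`], p. 29 [PDF 13], after (1.66): «The function under the
integral is bounded from below and above by positive constants γ₀, γ₁ dependent on d only, so we have
γ₀⟨∂₁B, ∂₁B⟩ ≦ ⟨B, Δ_kB⟩ ≦ γ₁⟨∂₁B, ∂₁B⟩. (1.67)»; same page, (1.65): «⟨B, Δ_kB⟩ = ⟨∂H_kB, ∂H_kB⟩.» and, after
(1.63), «H_kB is a minimum of ½⟨∂A, ∂A⟩ on the hyperplane {A : Q_kA = B, R∂*A = 0}».

**What is proved here (zero `sorry`; every `d`, every block side `n + 1 ≥ 1`, every `a > 0`).**  The objects are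
those of this seat's nodes 5–8 (`B5Hk103ScalarZd`, `B5Hk103Unique`, `B5Hk103Minimizer`, `B5Hk165ActionZd`): the
SCALAR analogue on the WHOLE fine lattice `ℤ^d` (sites `X d = Fin d → ℤ`, blocks `B n y` of side `n + 1` labelled
by the unit lattice `y ∈ ℤ^d`, plain block sums `Σ_{p ∈ B(y)} A(p) = (n+1)^d·B(y)` for «Q'A = B»), the Dirichlet
form in site units `energy A = Σ_μ Σ'_p (A(p) − A(p + e_μ))²` (`B5Hk103Minimizer.energy`; the SAME formula on the
unit lattice is `⟨∂₁B, ∂₁B⟩ = energy B`), the minimiser `HB` and the coarse action form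
`actionForm n a T B = Σ_{y'',y ∈ T} B(y'')B(y)((Q'G'Q'*)⁻¹(y'',y) − aδ_{y''y})` of node 8 (= `⟨B, Δ_kB⟩` of (1.65) in
the scalar dictionary «⟨∂A, ∂A⟩ = η^{d−2}·energy A, η = (n+1)⁻¹», by `B5Hk165ActionZd.energy_HB_eq'`).
* §1–§3 [folklore] lattice bookkeeping: the chart of the next block (`chart_add_e`, `sum_B_add_e`), telescoping
  along a direction (`sub_eq_sum_range`), Cauchy–Schwarz against the constant vector (`sq_sum_le`; the block count
  `card_B` is node 4's `B6QGQDecay237.card_B`), the one-block estimate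
  `((n+1)^d (B(y) − B(y+e_μ)))² ≤ (n+1)^{d+1}·R_μ(y)` (`block_sq_le`, `R_μ = blockBondSum`: the `μ`-bond energy of
  `A` over the `n+1` translates of the block), and the block resummation
  `Σ'_y R_μ(y) = (n+1)·Σ'_q (A(q) − A(q+e_μ))²` (`tsum_blockBondSum`, by node 5's `tsum_blocks` and translation
  invariance of `Σ'` on `ℤ^d`).
* §4 **`energy_blockAvg_le` — the `H¹`-STABILITY OF BLOCK AVERAGING ON `ℤ^d` WITH CONSTANT 1**: for every fine field
  `A` of finite Dirichlet energy and its field of block means `B`,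
  `(n+1)^d · energy B ≤ (n+1)² · energy A`, i.e. `⟨∂₁(Q'A), ∂₁(Q'A)⟩ ≤ ⟨∂A, ∂A⟩` in Bałaban's units (and the block
  means have finite energy, `summable_grad_sq_blockAvg`);
* §4 **`ineq167_lower_scalar` — (1.67), LEFT HALF, scalar, `ℤ^d`, `γ₀ = 1`**: `energy B ≤ actionForm n a T B` for
  every finitely supported coarse field `B` and every `a > 0` — the stability inequality at the competitor
  `A := HB` (node 7: `Q'(HB) = B`, `HB ∈ ℓ²`) combined with (1.65) `(n+1)²·energy HB = (n+1)^d·actionForm`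
  (node 8).

RELATION TO THE TREE (by name; nothing is imported from `Beta/`): `Beta.Ineq167Operator.ineq167_lower` /
`DelK_form_le_of_QvOp_eq` and `Beta.Ineq167OperatorUpper.ineq167_DelK` (unit b2b-balaban-beta-an5) prove (1.67) —
lower half with `γ₀ = 1`, and the upper half — for the GENUINE vector operator `Δ_k` of (1.65) on finite tori with
the typed averaging `Q_k`; the present file is the scalar, infinite-volume (`ℤ^d`, `Σ'`) counterpart of the LOWER
half only, in the whole-lattice line of nodes 5–8, with the finite-energy competitor class made explicit.

HONEST SCOPE.  (i) SCALAR analogue (plain block means, no gauge condition `R∂*A = 0`); (ii) WHOLE lattice `ℤ^d`,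
infinite volume, competitors of finite Dirichlet energy (`Σ'` statements need exactly this); (iii) the LEFT
inequality of (1.67) only — the RIGHT one, `⟨B, Δ_kB⟩ ≤ γ₁⟨∂₁B, ∂₁B⟩`, needs an interpolating right inverse of `Q'`
(or the momentum formula (1.66)) and is NOT treated here; (iv) `γ₀ = 1` is what the argument gives in the scalar
case; the print asserts only the existence of `γ₀(d) > 0`.

ABSOLUTE-RULE CENSUS: every theorem below is proved outright from the tree modules named above and Mathlib
(sorry-free; axioms `propext`, `Classical.choice`, `Quot.sound` only); no quoted statement is used as a hypothesis;
the hypotheses of the headline theorems are: finite `μ`-energies of `A`, the block-sum identity `Q'A = B`, `0 < a`,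
`supp B ⊆ T`.  Unit `b2b-balaban-pv23-g7` (surge node prover #23, gen 7; journal claim B5-167-LOWER-SCALAR-ZD);
value = kernel discharge (scalar, infinite volume), NOT summit progress.
-/

namespace Literature.MathematicalPhysics.QuantumFieldTheory.Balaban1983to89.B5Ineq167LowerZd

open Finset Real Filter Topology
open B6QGQLower276 B6QGQDecay237 B5Hk103ScalarZd B5Hk103Unique B5Hk103Minimizer B5Hk165ActionZd

noncomputable section

variable {d : ℕ}

/-! ## §1  Lattice bookkeeping: the next block, telescoping, Cauchy–Schwarz [folklore] -/

/-- The chart of the neighbouring block `y + e_μ` is the chart of `y` shifted by `n + 1` fine steps in direction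
`μ`. [folklore] -/
theorem chart_add_e (n : ℕ) (y : X d) (z : Fin d → Fin (n + 1)) (μ : Fin d) :
    chart n (y + e μ) z = chart n y z + ((n + 1 : ℕ) : ℤ) • e μ := by
  funext ν
  simp only [chart, side, Pi.add_apply, Pi.smul_apply, smul_eq_mul]
  push_cast
  ring

/-- A sum over the block of `y + e_μ` is the sum over the block of `y` of the summand shifted by `(n+1)e_μ`.
[folklore] -/
theorem sum_B_add_e (n : ℕ) (y : X d) (μ : Fin d) (f : X d → ℝ) :
    ∑ p ∈ B n (y + e μ), f p = ∑ p ∈ B n y, f (p + ((n + 1 : ℕ) : ℤ) • e μ) := by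
  rw [sum_B, sum_B]
  exact Finset.sum_congr rfl fun z _ => by rw [chart_add_e]

/-- Telescoping along a lattice vector `v`: `A(q) − A(q + m·v) = Σ_{t<m} (A(q + t·v) − A(q + t·v + v))`.
[folklore] -/
theorem sub_eq_sum_range (A : X d → ℝ) (q v : X d) (m : ℕ) :
    A q - A (q + (m : ℤ) • v) = ∑ t ∈ Finset.range m, (A (q + (t : ℤ) • v) - A (q + (t : ℤ) • v + v)) := by
  induction m with
  | zero => simp
  | succ m ih =>
    rw [Finset.sum_range_succ, ← ih]
    have : q + ((m + 1 : ℕ) : ℤ) • v = q + (m : ℤ) • v + v := by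
      rw [Nat.cast_succ, add_smul, one_smul, add_assoc]
    rw [this]
    ring

/-- Cauchy–Schwarz against the constant vector: `(Σ_{i∈s} f i)² ≤ #s · Σ_{i∈s} (f i)²`. [folklore] -/
theorem sq_sum_le {ι : Type*} (s : Finset ι) (f : ι → ℝ) :
    (∑ i ∈ s, f i) ^ 2 ≤ (s.card : ℝ) * ∑ i ∈ s, f i ^ 2 := by
  have h := Finset.sum_mul_sq_le_sq_mul_sq s f (fun _ => (1 : ℝ))
  simp only [mul_one, one_pow, Finset.sum_const, nsmul_eq_mul] at h
  simpa [mul_comm] using h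

/-! ## §2  One block, one direction [folklore] -/

/-- The block-mean difference across a face is the block mean of the `(n+1)`-step differences:
`(n+1)^d·(B(y) − B(y+e_μ)) = Σ_{p∈B(y)} (A(p) − A(p + (n+1)e_μ))`. [folklore] -/
theorem blockMean_sub (n : ℕ) (A Bf : X d → ℝ) (hAQ : ∀ y, ∑ p ∈ B n y, A p = ((n : ℝ) + 1) ^ d * Bf y)
    (y : X d) (μ : Fin d) :
    ((n : ℝ) + 1) ^ d * (Bf y - Bf (y + e μ)) = ∑ p ∈ B n y, (A p - A (p + ((n + 1 : ℕ) : ℤ) • e μ)) := by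
  rw [mul_sub, ← hAQ y, ← hAQ (y + e μ), sum_B_add_e, Finset.sum_sub_distrib]

/-- `R_μ(y) = Σ_{t<n+1} Σ_{p∈B(y)} (A(p + te_μ) − A(p + te_μ + e_μ))²`: the `μ`-bond energy of `A` summed over the
`n+1` translates `B(y) + te_μ` of the block. [folklore] -/
def blockBondSum (n : ℕ) (A : X d → ℝ) (μ : Fin d) (y : X d) : ℝ :=
  ∑ t ∈ Finset.range (n + 1), ∑ p ∈ B n y, (A (p + (t : ℤ) • e μ) - A (p + (t : ℤ) • e μ + e μ)) ^ 2

/-- `R_μ(y) ≥ 0`. [folklore] -/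
theorem blockBondSum_nonneg (n : ℕ) (A : X d → ℝ) (μ : Fin d) (y : X d) : 0 ≤ blockBondSum n A μ y :=
  Finset.sum_nonneg fun _ _ => Finset.sum_nonneg fun _ _ => sq_nonneg _

/-- **One block, one direction**: `((n+1)^d·(B(y) − B(y+e_μ)))² ≤ (n+1)^d·(n+1)·R_μ(y)` — Cauchy–Schwarz over the
`(n+1)^d` sites of the block, then over the `n+1` steps of the telescoping sum. [folklore] -/
theorem block_sq_le (n : ℕ) (A Bf : X d → ℝ) (hAQ : ∀ y, ∑ p ∈ B n y, A p = ((n : ℝ) + 1) ^ d * Bf y)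
    (y : X d) (μ : Fin d) :
    (((n : ℝ) + 1) ^ d * (Bf y - Bf (y + e μ))) ^ 2 ≤
      ((n : ℝ) + 1) ^ d * (((n : ℝ) + 1) * blockBondSum n A μ y) := by
  rw [blockMean_sub n A Bf hAQ y μ]
  have h1 := sq_sum_le (B n y) (fun p => A p - A (p + ((n + 1 : ℕ) : ℤ) • e μ))
  rw [card_B] at h1
  refine h1.trans (mul_le_mul_of_nonneg_left ?_ (by positivity))
  rw [blockBondSum, Finset.sum_comm, Finset.mul_sum]
  refine Finset.sum_le_sum fun p _ => ?_
  rw [sub_eq_sum_range A p (e μ) (n + 1)]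
  have h2 := sq_sum_le (Finset.range (n + 1)) (fun t => A (p + (t : ℤ) • e μ) - A (p + (t : ℤ) • e μ + e μ))
  rw [Finset.card_range, Nat.cast_succ] at h2
  exact h2

/-! ## §3  Summation over the blocks [folklore] -/

/-- Translates of a summable function on `ℤ^d` are summable. [folklore] -/
theorem summable_shift {g : X d → ℝ} (hg : Summable g) (v : X d) : Summable fun q => g (q + v) :=
  (Equiv.addRight v).summable_iff.2 hg

/-- Translation invariance of `Σ'` on `ℤ^d`. [folklore] -/
theorem tsum_shift (g : X d → ℝ) (v : X d) : ∑' q, g (q + v) = ∑' q, g q :=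
  (Equiv.addRight v).tsum_eq g

/-- `R_μ` is summable over the unit lattice when `A` has finite `μ`-energy. [folklore] -/
theorem summable_blockBondSum (n : ℕ) {A : X d → ℝ} {μ : Fin d}
    (hA : Summable fun q => (A q - A (q + e μ)) ^ 2) : Summable (blockBondSum n A μ) := by
  unfold blockBondSum
  refine summable_sum fun t _ => ?_
  exact summable_blocks n (summable_shift hA ((t : ℤ) • e μ))

/-- **Block resummation**: `Σ'_y R_μ(y) = (n+1)·Σ'_q (A(q) − A(q+e_μ))²` — each translate `t` contributes the full
`μ`-energy (node 5's `tsum_blocks` and translation invariance). [folklore] -/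
theorem tsum_blockBondSum (n : ℕ) {A : X d → ℝ} {μ : Fin d}
    (hA : Summable fun q => (A q - A (q + e μ)) ^ 2) :
    ∑' y, blockBondSum n A μ y = ((n : ℝ) + 1) * ∑' q, (A q - A (q + e μ)) ^ 2 := by
  unfold blockBondSum
  rw [Summable.tsum_finsetSum fun (t : ℕ) _ => summable_blocks n (summable_shift hA ((t : ℤ) • e μ))]
  have h : ∀ t ∈ Finset.range (n + 1),
      ∑' y, ∑ p ∈ B n y, (A (p + (t : ℤ) • e μ) - A (p + (t : ℤ) • e μ + e μ)) ^ 2 =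
        ∑' q, (A q - A (q + e μ)) ^ 2 := fun t _ => by
    rw [tsum_blocks n (summable_shift hA ((t : ℤ) • e μ))]
    exact tsum_shift (fun q => (A q - A (q + e μ)) ^ 2) ((t : ℤ) • e μ)
  rw [Finset.sum_congr rfl h, Finset.sum_const, Finset.card_range, nsmul_eq_mul, Nat.cast_succ]

/-! ## §4  The `H¹`-stability of block averaging, and (1.67) left half [print-located; proved outright] -/

/-- **Per direction**: if `A` has finite `μ`-energy and `B` is its field of block means, then `B` has finite
`μ`-energy on the unit lattice and `(n+1)^d·Σ'_y (B(y) − B(y+e_μ))² ≤ (n+1)²·Σ'_q (A(q) − A(q+e_μ))²`. [folklore] -/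
theorem dir_energy_blockAvg_le (n : ℕ) (A Bf : X d → ℝ) {μ : Fin d}
    (hA : Summable fun q => (A q - A (q + e μ)) ^ 2)
    (hAQ : ∀ y, ∑ p ∈ B n y, A p = ((n : ℝ) + 1) ^ d * Bf y) :
    (Summable fun y => (Bf y - Bf (y + e μ)) ^ 2) ∧
      ((n : ℝ) + 1) ^ d * ∑' y, (Bf y - Bf (y + e μ)) ^ 2 ≤
        ((n : ℝ) + 1) ^ 2 * ∑' q, (A q - A (q + e μ)) ^ 2 := by
  have hcd : (0 : ℝ) < ((n : ℝ) + 1) ^ d := by positivity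
  -- pointwise: (n+1)^d (ΔB)² ≤ (n+1)·R_μ
  have hpt : ∀ y, ((n : ℝ) + 1) ^ d * (Bf y - Bf (y + e μ)) ^ 2 ≤ ((n : ℝ) + 1) * blockBondSum n A μ y :=
    fun y => by
    have h := block_sq_le n A Bf hAQ y μ
    have h' : ((n : ℝ) + 1) ^ d * (((n : ℝ) + 1) ^ d * (Bf y - Bf (y + e μ)) ^ 2) ≤
        ((n : ℝ) + 1) ^ d * (((n : ℝ) + 1) * blockBondSum n A μ y) := by
      calc ((n : ℝ) + 1) ^ d * (((n : ℝ) + 1) ^ d * (Bf y - Bf (y + e μ)) ^ 2)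
          = (((n : ℝ) + 1) ^ d * (Bf y - Bf (y + e μ))) ^ 2 := by ring
        _ ≤ ((n : ℝ) + 1) ^ d * (((n : ℝ) + 1) * blockBondSum n A μ y) := h
    exact le_of_mul_le_mul_left h' hcd
  have hR : Summable (blockBondSum n A μ) := summable_blockBondSum n hA
  have hR' : Summable fun y => ((n : ℝ) + 1) * blockBondSum n A μ y := hR.mul_left _
  have hS1 : Summable fun y => ((n : ℝ) + 1) ^ d * (Bf y - Bf (y + e μ)) ^ 2 :=
    Summable.of_nonneg_of_le (fun y => by positivity) hpt hR'
  have hS : Summable fun y => (Bf y - Bf (y + e μ)) ^ 2 := (summable_mul_left_iff hcd.ne').1 hS1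
  refine ⟨hS, ?_⟩
  calc ((n : ℝ) + 1) ^ d * ∑' y, (Bf y - Bf (y + e μ)) ^ 2
      = ∑' y, ((n : ℝ) + 1) ^ d * (Bf y - Bf (y + e μ)) ^ 2 := by rw [tsum_mul_left]
    _ ≤ ∑' y, ((n : ℝ) + 1) * blockBondSum n A μ y := hS1.tsum_le_tsum hpt hR'
    _ = ((n : ℝ) + 1) * ∑' y, blockBondSum n A μ y := tsum_mul_left
    _ = ((n : ℝ) + 1) ^ 2 * ∑' q, (A q - A (q + e μ)) ^ 2 := by rw [tsum_blockBondSum n hA]; ring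

/-- Block means of a finite-energy field have finite energy on the unit lattice. [folklore] -/
theorem summable_grad_sq_blockAvg (n : ℕ) (A Bf : X d → ℝ) (μ : Fin d)
    (hA : Summable fun q => (A q - A (q + e μ)) ^ 2)
    (hAQ : ∀ y, ∑ p ∈ B n y, A p = ((n : ℝ) + 1) ^ d * Bf y) :
    Summable fun y => (Bf y - Bf (y + e μ)) ^ 2 :=
  (dir_energy_blockAvg_le n A Bf hA hAQ).1

/-- **The `H¹`-stability of block averaging on `ℤ^d`, constant 1**: for every fine field `A` with finite Dirichlet
energy and its field `B` of block means (`Σ_{p∈B(y)} A(p) = (n+1)^d B(y)`, i.e. `Q'A = B`),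
`(n+1)^d · energy B ≤ (n+1)² · energy A` — in Bałaban's units (`η = (n+1)⁻¹`, `⟨∂A, ∂A⟩ = η^{d−2}·energy A`):
`⟨∂₁(Q'A), ∂₁(Q'A)⟩ ≤ ⟨∂A, ∂A⟩`.  This is the competitor-free content of the left half of (1.67).
[cite: Balaban1984PropagatorsI, (1.67) p.29] -/
theorem energy_blockAvg_le (n : ℕ) (A Bf : X d → ℝ) (hA : ∀ μ, Summable fun q => (A q - A (q + e μ)) ^ 2)
    (hAQ : ∀ y, ∑ p ∈ B n y, A p = ((n : ℝ) + 1) ^ d * Bf y) :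
    ((n : ℝ) + 1) ^ d * energy Bf ≤ ((n : ℝ) + 1) ^ 2 * energy A := by
  unfold energy
  rw [Finset.mul_sum, Finset.mul_sum]
  exact Finset.sum_le_sum fun μ _ => (dir_energy_blockAvg_le n A Bf (hA μ) hAQ).2

/-- **(1.67), LEFT HALF, scalar, whole lattice `ℤ^d`, `γ₀ = 1`**: `⟨∂₁B, ∂₁B⟩ ≤ ⟨B, Δ_kB⟩`, i.e.
`energy B ≤ actionForm n a T B` for every coarse field `B` supported in the finset `T` and every `a > 0` — the
stability inequality at the minimiser `A := HB` (`Q'(HB) = B`, node 7) and (1.65)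
`(n+1)²·energy HB = (n+1)^d·actionForm` (node 8). [cite: Balaban1984PropagatorsI, (1.67) p.29] -/
theorem ineq167_lower_scalar (n : ℕ) {a : ℝ} (ha : 0 < a) (T : Finset (X d)) (Bf : X d → ℝ)
    (hT : ∀ y ∉ T, Bf y = 0) : energy Bf ≤ actionForm n a T Bf := by
  have h := energy_blockAvg_le n (HB n a T Bf) Bf (fun μ => summable_grad_sq (summable_HB_sq n ha T Bf) μ)
    (sum_B_HB n ha T Bf hT)
  rw [energy_HB_eq' n ha T Bf hT] at h
  exact le_of_mul_le_mul_left h (by positivity)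

/-- The same bound with the (n-independent) positivity of node 8 recorded alongside: `0 ≤ energy B ≤ actionForm`.
[folklore] -/
theorem energy_nonneg_le_actionForm (n : ℕ) {a : ℝ} (ha : 0 < a) (T : Finset (X d)) (Bf : X d → ℝ)
    (hT : ∀ y ∉ T, Bf y = 0) : 0 ≤ energy Bf ∧ energy Bf ≤ actionForm n a T Bf :=
  ⟨Finset.sum_nonneg fun _ _ => tsum_nonneg fun _ => sq_nonneg _, ineq167_lower_scalar n ha T Bf hT⟩

end

end Literature.MathematicalPhysics.QuantumFieldTheory.Balaban1983to89.B5Ineq167LowerZd
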